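import Mathlib.MeasureTheory.Integral.DominatedConvergence
import Mathlib.Topology.Order.MonotoneConvergence
import Mathlib.Data.NNReal.Basic
import HarnessLib

/-!
# The cylinder identity of a frozen continuous process extends past the freezing time

Topic `Literature/Probability/Process`; theorems only. A small real-analysis step in the
identification of scaling limits by TIME-LIMITED martingale observables (Chelkak–Duminil-Copin–
Hongler–Kemppainen–Smirnov, C. R. Math. 352 (2014), §3: the observable `M_{t ∧ T}(z)` is only
natural up to a deterministic time `T = T(z)` and is frozen afterwards): if a bounded real process
`X_u` with continuous paths is constant in `u ≥ T`, and the "cylinder identity"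
`∫ (X_t - X_s) Ψ dμ = 0` holds for all `s < t < T` (against a fixed bounded test function `Ψ`,
typically `ψ(W_{S_1}, …, W_{S_n})` with `S_i ≤ s`), then it holds for ALL `t ≥ s`: the case
`t ≥ T > s` by letting `t ↑ T` under the integral (dominated convergence), the case `s ≥ T`
trivially. This isolates, for reuse with other observables, the argument of
`Loewner.integral_observableProcess_cylinder_eq_zero_of_forall_lt`
(`RandomPlanarGeometry/ObservableDiscretePassage.lean`).

No definitions, no named facts.

## References

* D. Chelkak, H. Duminil-Copin, C. Hongler, A. Kemppainen, S. Smirnov, C. R. Math. Acad. Sci.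
  Paris 352 (2014) 157–161, §3.
-/

noncomputable section

open MeasureTheory Filter Set Topology
open scoped NNReal

namespace Literature.Probability.Process

variable {Ω : Type*} {mΩ : MeasurableSpace Ω} {μ : Measure Ω}

/-- **Extension of a cylinder identity past the freezing time.** Let `X : ℝ≥0 → Ω → ℝ` have
continuous paths, be a.e. strongly measurable at each time, bounded by `C`, and frozen after `T`
(`X_u = X_T` for `u ≥ T`); let `Ψ` be an a.e. strongly measurable test function with `|Ψ| ≤ 1`.
If `∫ (X_t - X_s) Ψ dμ = 0` for all `t` with `s < t < T`, then `∫ (X_t - X_s) Ψ dμ = 0` for every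
`t ≥ s` (finite measure). [cite: CDHKSCRAS2014, §3] -/
theorem integral_sub_mul_eq_zero_of_forall_lt_of_frozen [IsFiniteMeasure μ] {X : ℝ≥0 → Ω → ℝ}
    {T : ℝ≥0} (hfrozen : ∀ u, T ≤ u → ∀ ω, X u ω = X T ω) (hcont : ∀ ω, Continuous fun u ↦ X u ω)
    (hmeas : ∀ u, AEStronglyMeasurable (X u) μ) {C : ℝ} (hbd : ∀ u ω, |X u ω| ≤ C)
    {Ψ : Ω → ℝ} (hΨm : AEStronglyMeasurable Ψ μ) (hΨ1 : ∀ ω, |Ψ ω| ≤ 1) {s : ℝ≥0}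
    (h : ∀ t : ℝ≥0, s < t → t < T → ∫ ω, (X t ω - X s ω) * Ψ ω ∂μ = 0) {t : ℝ≥0} (hst : s ≤ t) :
    ∫ ω, (X t ω - X s ω) * Ψ ω ∂μ = 0 := by
  rcases hst.eq_or_lt with rfl | hst'
  · simp
  rcases lt_or_ge t T with htT | htT
  · exact h t hst' htT
  rcases le_or_gt T s with hsT | hsT
  · have h0 : ∀ ω, X t ω - X s ω = 0 := fun ω ↦ by
      rw [hfrozen t htT ω, hfrozen s hsT ω, sub_self]
    simp [h0]
  simp_rw [hfrozen t htT]
  -- approximate `T` from below by times `tm m ∈ (s, T)`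
  obtain ⟨tm, -, htm_mem, htm_lim⟩ := exists_seq_strictMono_tendsto' hsT
  have hm : ∀ m, ∫ ω, (X (tm m) ω - X s ω) * Ψ ω ∂μ = 0 := fun m ↦
    h (tm m) (htm_mem m).1 (htm_mem m).2
  have hmeas' : ∀ u, AEStronglyMeasurable (fun ω ↦ (X u ω - X s ω) * Ψ ω) μ := fun u ↦
    ((hmeas u).sub (hmeas s)).mul hΨm
  have hbd' : ∀ u ω, ‖(X u ω - X s ω) * Ψ ω‖ ≤ 2 * C := fun u ω ↦ by
    have hC : 0 ≤ C := (abs_nonneg _).trans (hbd u ω)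
    rw [Real.norm_eq_abs, abs_mul]
    have h1 : |X u ω - X s ω| ≤ 2 * C := by
      have h2 := abs_sub (X u ω) (X s ω)
      linarith [hbd u ω, hbd s ω]
    calc |X u ω - X s ω| * |Ψ ω| ≤ 2 * C * 1 :=
          mul_le_mul h1 (hΨ1 ω) (abs_nonneg _) (by linarith)
      _ = 2 * C := mul_one _
  have hlim : Tendsto (fun m ↦ ∫ ω, (X (tm m) ω - X s ω) * Ψ ω ∂μ) atTop
      (𝓝 (∫ ω, (X T ω - X s ω) * Ψ ω ∂μ)) := by
    refine tendsto_integral_of_dominated_convergence (fun _ ↦ 2 * C) (fun m ↦ hmeas' _)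
      (integrable_const _) (fun m ↦ ae_of_all _ fun ω ↦ hbd' _ ω) (ae_of_all _ fun ω ↦ ?_)
    exact ((((hcont ω).tendsto T).comp htm_lim).sub tendsto_const_nhds).mul tendsto_const_nhds
  have h0 : Tendsto (fun m ↦ ∫ ω, (X (tm m) ω - X s ω) * Ψ ω ∂μ) atTop (𝓝 0) := by
    simp_rw [hm]
    exact tendsto_const_nhds
  exact tendsto_nhds_unique hlim h0

end Literature.Probability.Process

end
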